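import Literature.LinearAlgebra.Matrix.CyclotomicIntegerMatrixClassesPrimePower
import Literature.NumberTheory.NumberFields.CyclotomicFieldsDegreeLeEightClassNumber
import Literature.NumberTheory.NumberFields.CyclotomicFieldElevenClassNumber
import HarnessLib

/-!
# Class number one: integer matrices with characteristic polynomial `Φ_d`, `φ(d) ≤ 8` or `d = 11`, form ONE
# `GL(ℤ)`-class; the elements of order `4, 7, 8, 9, 11, 16` of `GL_2(ℤ), GL_6(ℤ), GL_4(ℤ), GL_6(ℤ), GL_{10}(ℤ),
# GL_8(ℤ)` are all conjugate (Latimer–MacDuffee–Taussky for `f = Φ_d` with `h(ℚ(ζ_d)) = 1`)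

[topic LinearAlgebra/Matrix] Lane `lit-hodgefound` (Track 2 foundations library), seat p15 generation 39, row g39-#4 —
sequel of g39-#2 `CyclotomicIntegerMatrixClasses` (`#{χ_B = Φ_n}/GL(ℤ) = h(ℚ(ζ_n))`) and g39-#3
`CyclotomicIntegerMatrixClassesPrimePower` (prime-power order; the Mathlib instances `d = 3, 5`), now fed with the
tree's cyclotomic class numbers (`Literature.NumberTheory.NumberFields.classNumber_eq_one_of_isCyclotomicExtension_of_totient_le_eight`:
`h(ℚ(ζ_d)) = 1` for `d > 2`, `φ(d) ≤ 8`; `classNumber_eq_one_of_isCyclotomicExtension_eleven`).  THEOREMS ONLY (no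
definition, no instance, no named fact; D-0026 net Literature debt `0`; no `sorry`).

## Sources, VERBATIM

J. Brzeziński, *On two classical theorems in the theory of orders*, J. Number Theory 34 (1990) 21–32
[Brzezinski1990] (held `paper:doi-10-1016-0022-314x-90-90049-w`, p0001), **(0.1) THEOREM** (Latimer–MacDuffee 1933
[LatimerMacduffee1933], Taussky 1949 [Taussky1949]): «Let `Λ = M_n(ℤ)` and let `S = ℤ[θ]`, where `f(θ) = 0` for a
monic separable polynomial `f ∈ ℤ[X]` of degree `n`. Then there is a one-to-one correspondence between the
`Λ* = GL_n(ℤ)`-orbits on the (ring-)embeddings of `S` into `Λ` and the ideal classes of `S`. […] there is a bijection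
between the embeddings and the solutions to `f(X) = 0` in `Λ`.»  With `f = Φ_d`, `S = ℤ[ζ_d]` the maximal order, and
`h(ℚ(ζ_d)) = 1` — L. C. Washington, *Introduction to Cyclotomic Fields* [Washington1997], Thm. 11.1
(Masley–Montgomery: `h(ℚ(ζ_d)) = 1` iff `φ(d) ≤ 20` or `d ∈ {35, 45, 84}`; the tree proves the cases `φ(d) ≤ 8` and
`d = 11`) — there is exactly ONE class.

## What is formalised

* §1 the principle: **`h(K) = 1` for a cyclotomic field `K = ℚ(ζ_n)` ⟹ any two integer `φ(n) × φ(n)` matrices with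
  `χ = Φ_n` are `GL(ℤ)`-conjugate** (`exists_isUnit_conj_of_charpoly_eq_cyclotomic_of_classNumber_eq_one`), and any two
  elements of order `p^{k+1}` of `GL_{φ(p^{k+1})}(ℤ)` are conjugate
  (`isConj_of_orderOf_eq_prime_pow_of_classNumber_eq_one`).
* §2 unconditionally, through the tree's class numbers: **for every `d > 2` with `φ(d) ≤ 8`** (the sixteen values
  `3, 4, 5, 6, 7, 8, 9, 10, 12, 14, 15, 16, 18, 20, 24, 30`) **and for `d = 11`, any two integer matrices with
  characteristic polynomial `Φ_d` are `GL_{φ(d)}(ℤ)`-conjugate**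
  (`exists_isUnit_conj_of_charpoly_eq_cyclotomic_of_totient_le_eight`, `…_eleven`); **for every prime power
  `q = p^{k+1} > 2` with `φ(q) ≤ 8` (`q = 3, 4, 5, 7, 8, 9, 16`) any two elements of order `q` of `GL_{φ(q)}(ℤ)` are
  conjugate** (`isConj_of_orderOf_eq_prime_pow_of_totient_le_eight`), spelled out for `q = 4` (`GL_2(ℤ)`), `7`
  (`GL_6(ℤ)`), `8` (`GL_4(ℤ)`), `9` (`GL_6(ℤ)`), `16` (`GL_8(ℤ)`), and `q = 11` (`GL_{10}(ℤ)`, `isConj_of_orderOf_eq_eleven`);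
  `q = 3, 5` are g39-#3's `isConj_of_orderOf_eq_three/five`.

Not here: `φ(d) ∈ {12, 16, 18, 20}` beyond `d = 11` (class number one holds but is not yet in the tree), composite
non-prime-power ORDERS (`χ` need not be `Φ_d`), and `h > 1` (first at `d = 23`).

## References
* [Brzezinski1990] J. Brzeziński, J. Number Theory 34 (1990) 21–32, (0.1) Theorem. [cite: Brzezinski1990, (0.1) Theorem, p. 21]
* [Washington1997] L. C. Washington, *Introduction to Cyclotomic Fields*, 2nd ed., GTM 83, Thm. 11.1.
* [LatimerMacduffee1933] C. G. Latimer, C. C. MacDuffee, Ann. of Math. 34 (1933) 313–316.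
* [Taussky1949] O. Taussky, Canad. J. Math. 1 (1949) 300–302, Thms. 1–4.
-/

noncomputable section

open scoped Classical nonZeroDivisors NumberField
open Polynomial Module Submodule

namespace Literature.LinearAlgebra.Matrix.CyclotomicIntegerMatrixClassesClassNumberOne

open Literature.LinearAlgebra.Matrix.CyclotomicIntegerMatrixClasses
  (natCard_quot_conj_charpoly_cyclotomic natCard_quot_isConj_orderOf_eq_prime)
open Literature.LinearAlgebra.Matrix.CyclotomicIntegerMatrixClassesPrimePower
  (natCard_quot_isConj_orderOf_eq_prime_pow)
open Literature.NumberTheory.NumberFields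
  (classNumber_eq_one_of_isCyclotomicExtension_of_totient_le_eight classNumber_eq_one_of_isCyclotomicExtension_eleven)

/-! ## §0 Plumbing: one class ⟹ all related -/

/-- From `Nat.card (Quot r) = 1` for an equivalence relation `r`: any two elements are related. [folklore] -/
private theorem rel_of_natCard_quot_eq_one {α : Type*} {r : α → α → Prop} (hr : Equivalence r)
    (h : Nat.card (Quot r) = 1) (a b : α) : r a b := by
  have hsub : Subsingleton (Quot r) := (Nat.card_eq_one_iff_unique.mp h).1
  exact hr.eqvGen_iff.mp (Quot.eqvGen_exact (Subsingleton.elim (Quot.mk r a) (Quot.mk r b)))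

/-- `IsConj` pulled back to a subtype of a monoid is an equivalence relation. [folklore] -/
private theorem equivalence_isConj_subtype {M : Type*} [Monoid M] (P : M → Prop) :
    Equivalence (fun g g' : {g : M // P g} => IsConj g.1 g'.1) :=
  ⟨fun g => IsConj.refl g.1, fun h => IsConj.symm h, fun h1 h2 => IsConj.trans h1 h2⟩

/-- The relation `∃ Q ∈ GL_N(ℤ), QB = B′Q` pulled back to a subtype of `M_N(ℤ)` is an equivalence relation.
[folklore] -/
private theorem equivalence_conj_subtype {N : ℕ} (P : _root_.Matrix (Fin N) (Fin N) ℤ → Prop) :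
    Equivalence (fun B B' : {B : _root_.Matrix (Fin N) (Fin N) ℤ // P B} =>
      ∃ Q : _root_.Matrix (Fin N) (Fin N) ℤ, IsUnit Q.det ∧ Q * B.1 = B'.1 * Q) := by
  refine ⟨fun B => ⟨1, by simp⟩, ?_, ?_⟩
  · rintro B B' ⟨Q, hQ, h⟩
    obtain ⟨u, rfl⟩ := (Matrix.isUnit_iff_isUnit_det Q).mpr hQ
    refine ⟨((u⁻¹ : (_root_.Matrix (Fin N) (Fin N) ℤ)ˣ) : _root_.Matrix (Fin N) (Fin N) ℤ),
      (Matrix.isUnit_iff_isUnit_det _).mp (Units.isUnit _), ?_⟩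
    calc ((u⁻¹ : (_root_.Matrix (Fin N) (Fin N) ℤ)ˣ) : _root_.Matrix (Fin N) (Fin N) ℤ) * B'.1
        = ↑u⁻¹ * B'.1 * (↑u * ↑u⁻¹) := by rw [Units.mul_inv, mul_one]
      _ = ↑u⁻¹ * (B'.1 * ↑u) * ↑u⁻¹ := by simp only [mul_assoc]
      _ = ↑u⁻¹ * (↑u * B.1) * ↑u⁻¹ := by rw [h]
      _ = ↑u⁻¹ * ↑u * B.1 * ↑u⁻¹ := by simp only [mul_assoc]
      _ = B.1 * ↑u⁻¹ := by rw [Units.inv_mul, one_mul]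
  · rintro B B' B'' ⟨Q, hQ, h⟩ ⟨Q', hQ', h'⟩
    refine ⟨Q' * Q, ?_, ?_⟩
    · rw [Matrix.det_mul]; exact hQ'.mul hQ
    · rw [mul_assoc, h, ← mul_assoc, h', mul_assoc]

/-! ## §1 The principle: `h(ℚ(ζ_n)) = 1` ⟹ one class -/

section Principle

/-- **If `h(ℚ(ζ_n)) = 1` then any two integer `N × N` matrices (`N = φ(n)`) with characteristic polynomial `Φ_n` are
conjugate by an element of `GL_N(ℤ)`** — the class-number-one case of the Latimer–MacDuffee–Taussky
correspondence for `f = Φ_n`, `S = ℤ[ζ_n]` maximal (g39-#2's count `= h`). [cite: Brzezinski1990, (0.1) Theorem (with `f = Φ_n`, `S = ℤ[ζ_n]`), p. 21] [cite: Taussky1949, Thms. 1–4] -/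
theorem exists_isUnit_conj_of_charpoly_eq_cyclotomic_of_classNumber_eq_one {n : ℕ} [NeZero n] {N : ℕ}
    (hN : n.totient = N) (K : Type) [Field K] [NumberField K] (hK : IsCyclotomicExtension {n} ℚ K)
    (h1 : NumberField.classNumber K = 1) (B B' : _root_.Matrix (Fin N) (Fin N) ℤ)
    (hB : B.charpoly = cyclotomic n ℤ) (hB' : B'.charpoly = cyclotomic n ℤ) :
    ∃ Q : _root_.Matrix (Fin N) (Fin N) ℤ, IsUnit Q.det ∧ Q * B = B' * Q := by
  haveI := hK
  have hcard := natCard_quot_conj_charpoly_cyclotomic K hN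
  rw [show Fintype.card (ClassGroup (𝓞 K)) = 1 from h1] at hcard
  exact rel_of_natCard_quot_eq_one (equivalence_conj_subtype _) hcard ⟨B, hB⟩ ⟨B', hB'⟩

/-- **If `h(ℚ(ζ_{p^{k+1}})) = 1` then any two elements of order `p^{k+1}` of `GL_N(ℤ) = (M_N(ℤ))ˣ`, `N = φ(p^{k+1})`,
are conjugate** (g39-#3's count `= h`). [cite: Brzezinski1990, (0.1) Theorem (with `f = Φ_{p^{k+1}}`: «the `Λ* = GL_n(ℤ)`-orbits … by conjugation»), p. 21] [cite: Taussky1949, Thms. 1–4] -/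
theorem isConj_of_orderOf_eq_prime_pow_of_classNumber_eq_one {p : ℕ} [Fact p.Prime] {k N : ℕ}
    (hN : (p ^ (k + 1)).totient = N) (K : Type) [Field K] [NumberField K]
    (hK : IsCyclotomicExtension {p ^ (k + 1)} ℚ K) (h1 : NumberField.classNumber K = 1)
    (g g' : (_root_.Matrix (Fin N) (Fin N) ℤ)ˣ) (hg : orderOf g = p ^ (k + 1)) (hg' : orderOf g' = p ^ (k + 1)) :
    IsConj g g' := by
  haveI := hK
  have hcard := natCard_quot_isConj_orderOf_eq_prime_pow hN K
  rw [show Fintype.card (ClassGroup (𝓞 K)) = 1 from h1] at hcard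
  exact rel_of_natCard_quot_eq_one (equivalence_isConj_subtype _) hcard ⟨g, hg⟩ ⟨g', hg'⟩

/-- **If `h(ℚ(ζ_p)) = 1` (`p` prime) then any two elements of order `p` of `GL_{p−1}(ℤ)` are conjugate** (g39-#2's
count `= h`). [cite: Brzezinski1990, (0.1) Theorem (with `f = Φ_p`, `n = p − 1`), p. 21] [cite: Taussky1949, Thms. 1–4] -/
theorem isConj_of_orderOf_eq_prime_of_classNumber_eq_one {p : ℕ} [Fact p.Prime] (K : Type) [Field K] [NumberField K]
    (hK : IsCyclotomicExtension {p} ℚ K) (h1 : NumberField.classNumber K = 1)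
    (g g' : (_root_.Matrix (Fin (p - 1)) (Fin (p - 1)) ℤ)ˣ) (hg : orderOf g = p) (hg' : orderOf g' = p) :
    IsConj g g' := by
  haveI := hK
  have hcard := natCard_quot_isConj_orderOf_eq_prime (p := p) K
  rw [show Fintype.card (ClassGroup (𝓞 K)) = 1 from h1] at hcard
  exact rel_of_natCard_quot_eq_one (equivalence_isConj_subtype _) hcard ⟨g, hg⟩ ⟨g', hg'⟩

end Principle

/-! ## §2 Unconditionally: `φ(d) ≤ 8`, and `d = 11` -/

section ClassNumberOne

/-- **For every `d > 2` with `φ(d) ≤ 8` — `d ∈ {3, 4, 5, 6, 7, 8, 9, 10, 12, 14, 15, 16, 18, 20, 24, 30}` — any two integer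
`φ(d) × φ(d)` matrices with characteristic polynomial `Φ_d` are conjugate by an element of `GL_{φ(d)}(ℤ)`**: one
class, since `h(ℚ(ζ_d)) = 1` (the tree's `classNumber_eq_one_of_isCyclotomicExtension_of_totient_le_eight`).
[cite: Brzezinski1990, (0.1) Theorem (with `f = Φ_d`), p. 21] [cite: Washington1997, Thm. 11.1] -/
theorem exists_isUnit_conj_of_charpoly_eq_cyclotomic_of_totient_le_eight {d : ℕ} (hd : 2 < d)
    (h8 : d.totient ≤ 8) {N : ℕ} (hN : d.totient = N) (B B' : _root_.Matrix (Fin N) (Fin N) ℤ)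
    (hB : B.charpoly = cyclotomic d ℤ) (hB' : B'.charpoly = cyclotomic d ℤ) :
    ∃ Q : _root_.Matrix (Fin N) (Fin N) ℤ, IsUnit Q.det ∧ Q * B = B' * Q := by
  haveI : NeZero d := ⟨by omega⟩
  exact exists_isUnit_conj_of_charpoly_eq_cyclotomic_of_classNumber_eq_one hN (CyclotomicField d ℚ)
    (CyclotomicField.isCyclotomicExtension d ℚ)
    (classNumber_eq_one_of_isCyclotomicExtension_of_totient_le_eight (CyclotomicField d ℚ)
      (CyclotomicField.isCyclotomicExtension d ℚ) hd h8) B B' hB hB'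

/-- **Any two integer `10 × 10` matrices with characteristic polynomial `Φ_{11}` are `GL_{10}(ℤ)`-conjugate**
(`h(ℚ(ζ_{11})) = 1`, the tree's `classNumber_eq_one_of_isCyclotomicExtension_eleven`). [cite: Brzezinski1990, (0.1) Theorem (with `f = Φ_11`), p. 21] [cite: Washington1997, Thm. 11.1] -/
theorem exists_isUnit_conj_of_charpoly_eq_cyclotomic_eleven (B B' : _root_.Matrix (Fin 10) (Fin 10) ℤ)
    (hB : B.charpoly = cyclotomic 11 ℤ) (hB' : B'.charpoly = cyclotomic 11 ℤ) :
    ∃ Q : _root_.Matrix (Fin 10) (Fin 10) ℤ, IsUnit Q.det ∧ Q * B = B' * Q :=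
  exists_isUnit_conj_of_charpoly_eq_cyclotomic_of_classNumber_eq_one
    ((Nat.totient_prime (by norm_num)).trans rfl) (CyclotomicField 11 ℚ) (CyclotomicField.isCyclotomicExtension 11 ℚ)
    (classNumber_eq_one_of_isCyclotomicExtension_eleven (CyclotomicField 11 ℚ)
      (CyclotomicField.isCyclotomicExtension 11 ℚ)) B B' hB hB'

/-- **For every prime power `q = p^{k+1} > 2` with `φ(q) ≤ 8` — `q ∈ {3, 4, 5, 7, 8, 9, 16}` — any two elements of
order `q` of `GL_{φ(q)}(ℤ)` are conjugate.** [cite: Brzezinski1990, (0.1) Theorem (with `f = Φ_q`), p. 21] [cite: Washington1997, Thm. 11.1] -/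
theorem isConj_of_orderOf_eq_prime_pow_of_totient_le_eight {p : ℕ} [Fact p.Prime] {k : ℕ}
    (hq : 2 < p ^ (k + 1)) (h8 : (p ^ (k + 1)).totient ≤ 8) {N : ℕ} (hN : (p ^ (k + 1)).totient = N)
    (g g' : (_root_.Matrix (Fin N) (Fin N) ℤ)ˣ) (hg : orderOf g = p ^ (k + 1)) (hg' : orderOf g' = p ^ (k + 1)) :
    IsConj g g' := by
  haveI : NeZero (p ^ (k + 1)) := ⟨by omega⟩
  exact isConj_of_orderOf_eq_prime_pow_of_classNumber_eq_one hN (CyclotomicField (p ^ (k + 1)) ℚ)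
    (CyclotomicField.isCyclotomicExtension (p ^ (k + 1)) ℚ)
    (classNumber_eq_one_of_isCyclotomicExtension_of_totient_le_eight (CyclotomicField (p ^ (k + 1)) ℚ)
      (CyclotomicField.isCyclotomicExtension (p ^ (k + 1)) ℚ) hq h8) g g' hg hg'

/-- **Any two elements of order `4` of `GL_2(ℤ)` are conjugate** (`h(ℚ(i)) = 1`). [cite: Brzezinski1990, (0.1) Theorem (with `f = Φ_4 = X² + 1`), p. 21] [cite: Washington1997, Thm. 11.1] -/
theorem isConj_of_orderOf_eq_four (g g' : (_root_.Matrix (Fin 2) (Fin 2) ℤ)ˣ) (hg : orderOf g = 4)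
    (hg' : orderOf g' = 4) : IsConj g g' :=
  haveI : Fact (Nat.Prime 2) := ⟨Nat.prime_two⟩
  isConj_of_orderOf_eq_prime_pow_of_totient_le_eight (p := 2) (k := 1) (by norm_num) (by decide) (by decide)
    g g' hg hg'

/-- **Any two elements of order `7` of `GL_6(ℤ)` are conjugate** (`h(ℚ(ζ_7)) = 1`). [cite: Brzezinski1990, (0.1) Theorem (with `f = Φ_7`), p. 21] [cite: Washington1997, Thm. 11.1] -/
theorem isConj_of_orderOf_eq_seven (g g' : (_root_.Matrix (Fin 6) (Fin 6) ℤ)ˣ) (hg : orderOf g = 7)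
    (hg' : orderOf g' = 7) : IsConj g g' :=
  haveI : Fact (Nat.Prime 7) := ⟨by norm_num⟩
  isConj_of_orderOf_eq_prime_pow_of_totient_le_eight (p := 7) (k := 0) (by norm_num) (by decide) (by decide)
    g g' hg hg'

/-- **Any two elements of order `8` of `GL_4(ℤ)` are conjugate** (`h(ℚ(ζ_8)) = 1`). [cite: Brzezinski1990, (0.1) Theorem (with `f = Φ_8 = X⁴ + 1`), p. 21] [cite: Washington1997, Thm. 11.1] -/
theorem isConj_of_orderOf_eq_eight (g g' : (_root_.Matrix (Fin 4) (Fin 4) ℤ)ˣ) (hg : orderOf g = 8)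
    (hg' : orderOf g' = 8) : IsConj g g' :=
  haveI : Fact (Nat.Prime 2) := ⟨Nat.prime_two⟩
  isConj_of_orderOf_eq_prime_pow_of_totient_le_eight (p := 2) (k := 2) (by norm_num) (by decide) (by decide)
    g g' hg hg'

/-- **Any two elements of order `9` of `GL_6(ℤ)` are conjugate** (`h(ℚ(ζ_9)) = 1`). [cite: Brzezinski1990, (0.1) Theorem (with `f = Φ_9`), p. 21] [cite: Washington1997, Thm. 11.1] -/
theorem isConj_of_orderOf_eq_nine (g g' : (_root_.Matrix (Fin 6) (Fin 6) ℤ)ˣ) (hg : orderOf g = 9)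
    (hg' : orderOf g' = 9) : IsConj g g' :=
  haveI : Fact (Nat.Prime 3) := ⟨Nat.prime_three⟩
  isConj_of_orderOf_eq_prime_pow_of_totient_le_eight (p := 3) (k := 1) (by norm_num) (by decide) (by decide)
    g g' hg hg'

/-- **Any two elements of order `16` of `GL_8(ℤ)` are conjugate** (`h(ℚ(ζ_16)) = 1`). [cite: Brzezinski1990, (0.1) Theorem (with `f = Φ_16 = X⁸ + 1`), p. 21] [cite: Washington1997, Thm. 11.1] -/
theorem isConj_of_orderOf_eq_sixteen (g g' : (_root_.Matrix (Fin 8) (Fin 8) ℤ)ˣ) (hg : orderOf g = 16)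
    (hg' : orderOf g' = 16) : IsConj g g' :=
  haveI : Fact (Nat.Prime 2) := ⟨Nat.prime_two⟩
  isConj_of_orderOf_eq_prime_pow_of_totient_le_eight (p := 2) (k := 3) (by norm_num) (by decide) (by decide)
    g g' hg hg'

/-- **Any two elements of order `11` of `GL_{10}(ℤ)` are conjugate** (`h(ℚ(ζ_11)) = 1`, the tree's
`classNumber_eq_one_of_isCyclotomicExtension_eleven`). [cite: Brzezinski1990, (0.1) Theorem (with `f = Φ_11`), p. 21] [cite: Washington1997, Thm. 11.1] -/
theorem isConj_of_orderOf_eq_eleven (g g' : (_root_.Matrix (Fin 10) (Fin 10) ℤ)ˣ) (hg : orderOf g = 11)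
    (hg' : orderOf g' = 11) : IsConj g g' :=
  haveI : Fact (Nat.Prime 11) := ⟨by norm_num⟩
  isConj_of_orderOf_eq_prime_of_classNumber_eq_one (p := 11) (CyclotomicField 11 ℚ)
    (CyclotomicField.isCyclotomicExtension 11 ℚ)
    (classNumber_eq_one_of_isCyclotomicExtension_eleven (CyclotomicField 11 ℚ)
      (CyclotomicField.isCyclotomicExtension 11 ℚ)) g g' hg hg'

end ClassNumberOne

end Literature.LinearAlgebra.Matrix.CyclotomicIntegerMatrixClassesClassNumberOne
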